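import Summits.CriticalPhenomena.Ising3D.Control2DL11OpeUA
import Summits.CriticalPhenomena.Ising3D.Control2DL11OpeLA
import Mathlib.Tactic.NormNum
import HarnessLib

/-!
# The 2D control's `c` datum TWO-SIDED on the kernel path at Λ = 11: `0.4995748 < c < 0.5089212`
(cell `pub-ising3x`, seat controls-1 gen 21; KERNEL PATH for the 2D γ-certificates, kind `ope2`, both senses — CONTROL-ONLY)

HONEST FRAMING: lottery ticket; floor = tightest certified 3D Ising CFT bounds; no exact-solution
claim without a proof. CONTROL-ONLY: `d = 2`, global blocks, `Δ_σ = 1/8` exact, the 2D axiom set `A2D′` with the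
CERTIFIED `ε` box `[49/50, 20001/20000]` as scalar input (scalars in the box `∪ [2, ∞)`, stress tensor at `(2,2)` + spin-2 gap `1`,
unitarity) and the Virasoro Ward identity `p_T = Δ_σ²/(2c)` as a HYPOTHESIS on the datum; nothing about `d = 3`.

`Control2DOpeTwoSided.cTwoSided_rb6_L11` (controls-1 g12) took the two RB-6 `ope2` certificates j136827 (Λ = 11, E₀ = 32; lower P = 153511/10⁷, upper P = 156383/10⁷) as
HYPOTHESES (`hlo : OpeLowerA2D …`, `hhi : OpeUpperA2D …`, each reader A ∧ reader B PASS). Both are now THEOREMS with every obligation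
re-decided in the Lean kernel: `opeUpper_2d_L11_opeUA` (`Control2DL11OpeUA`, controls-1 g20, bridge `opeUpper_half_of_cellsZ`) and `opeLower_2d_L11_opeLA`
(`Control2DL11OpeLA`, controls-1 g21, bridge `opeLower_half_of_cellsZ` with the explicit tail majorant of `Control2DOpeTail`). This file only
composes them: **`cTwoSided_2d_L11`** — for every parity-symmetric unitary solution of the 2D `⟨σσσσ⟩` sum rule at `Δ_σ = 1/8` under `A2D′`
with that `ε` box whose total `(2,2)` coefficient is `(1/8)²/(2c)`, `c > 0`: `78125/156383 ≈ 0.4995748 < c < 78125/153511 ≈ 0.5089212`; the 2D Ising value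
`c = 1/2` lies inside. Zero grant compute. No facts, standard axioms only. [cite: RattazziEtAl2008, §5]
-/

namespace Summit.CriticalPhenomena.Ising3D.Control2D

open Set
open Literature.MathematicalPhysics.QuantumFieldTheory.ConformalBootstrap3D

/-- **2D control, `c` two-sided, kernel-complete at Λ = 11**: `CTwoSided (1/8) 2 1 (49/50) (20001/20000) ((1/8)²/(2·P_hi)) ((1/8)²/(2·P_lo))`
with `P_hi = 156383/10^7`, `P_lo = 153511/10^7`, i.e. `78125/156383 ≈ 0.4995748 < c < 78125/153511 ≈ 0.5089212` — `cTwoSided_rb6_L11` with BOTH hypotheses discharged by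
kernel replays. CONTROL-ONLY (d = 2). [cite: RattazziEtAl2008, §5] -/
theorem cTwoSided_2d_L11 :
    CTwoSided (1 / 8) 2 1 (49 / 50) (20001 / 20000)
      ((1 / 8 : ℝ) ^ 2 / (2 * (156383 / 10 ^ 7))) ((1 / 8 : ℝ) ^ 2 / (2 * (153511 / 10 ^ 7))) := by
  refine cTwoSided_rb6_L11 ?_ ?_
  · rw [show (153511 : ℝ) / 10 ^ 7 = 153511 / 10000000 by norm_num]
    exact opeLower_2d_L11_opeLA
  · rw [show (156383 : ℝ) / 10 ^ 7 = 156383 / 10000000 by norm_num]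
    exact opeUpper_2d_L11_opeUA

end Summit.CriticalPhenomena.Ising3D.Control2D
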